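import Mathlib
import Literature.Analysis.FluidPDE.GalerkinFlow
import Literature.Analysis.FluidPDE.NSGalerkinTrajectory
import Literature.Analysis.FunctionSpaces.TorusLinearisedFormTruncation
import Summits.AnomalousDissipation.AnomalousDissipation.Theses.WazewskiBlock
import Summits.AnomalousDissipation.AnomalousDissipation.Theorems.WazewskiBlockUniformGalerkinTrapLandingEquivalence
import Summits.AnomalousDissipation.AnomalousDissipation.Theorems.WazewskiBlockUniformGalerkinTrapStubAeOrbitMem
import Summits.AnomalousDissipation.AnomalousDissipation.Theorems.WazewskiBlockUniformGalerkinTrapStubCalibration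
import Summits.AnomalousDissipation.AnomalousDissipation.Theorems.WazewskiBlockUniformGalerkinTrapStubGalerkinRegularity
import Summits.AnomalousDissipation.AnomalousDissipation.Theorems.WazewskiBlockUniformGalerkinTrapStubWorkLipschitz
import HarnessLib

/-!
# Skeleton — crux stmt-AnomalousDissipation-10352 (`WazewskiBlock.UniformGalerkinTrap`), line `SketchIdeator5`
# (idea card `mane-calibrated-injection-floor`), lead prover-line-stmt-AnomalousDissipation-10352-a1-0

Composition (kernel-checked modulo the registered `stub_*`; `UniformGalerkinTrap_of` is the only theorem concluding
the crux by name):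

  stub_boundedExcessLoudCore (THE BET, statistical: for every small ν and large N an invariant Borel probability law of
    the order-N Galerkin COEFFICIENT semiflow `galerkinCoeffFlow ν f̂|_{≤N}`, carried by the bounded capped core
    {phase space, KE ≤ E, ‖∇·‖² ≤ G(ν)}, with mean injection β and cumulative β-EXCESS of the injection ≤ C along a.e.
    orbit, √(2 C L) ≤ β - ε₀ for the explicit ν-, N-free time-Lipschitz constant L of the injection)
  + stub_galerkinRegularity (measurability / orbit continuity / semigroup law of the coefficient semiflow, continuity of
    the injection functional, closedness of the capped core — tree plumbing)
  + stub_aeOrbitMem (invariant law carried by a closed set ⇒ a.e. forward orbit stays in it — abstract)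
  + stub_calibration (Mañé's coboundary lemma, semiflow/measure form: bounded excess ⇒ a.e. bounded DEFICIT — abstract)
  + stub_workLipschitz (the injection is L-Lipschitz in time along energy-bounded Galerkin orbits — field level)
  ⟹ (glue, proved here) the orbit-level statement `BoundedDeficitLoudCore`
  ⟹ stub_transfer (proved: `stub_floor` = deficit–Lipschitz floor lemma + forward orbit + p105977) ⟹ the crux.

Typing decision (lead a1): the ideator's v1 Transfer quantified measures on the function space `𝕋³ → E³` with its product
σ-algebra, under which the capped core contains no nonempty measurable set (junk-false); everything statistical is typed
here on the finite-dimensional Borel coefficient space `↥(freqBall N) → ℂ³`, the tree's idiom (`map_galerkinCoeffFlow_eq_self`).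
β, C are per-(ν, N); only ε₀ and the floor inequality are uniform.
-/

noncomputable section

-- `Summit.<Summit>.<Problem>` is the mandated summit-side namespace (CONVENTIONS §2); deliberate duplicate.
set_option linter.dupNamespace false

namespace Summit.AnomalousDissipation.AnomalousDissipation.Cruxes.UniformGalerkinTrap.SketchIdeator5

open scoped InnerProductSpace ENNReal NNReal
open MeasureTheory Set Filter Topology
open Literature.Analysis.FunctionSpaces Literature.Analysis.FunctionSpaces.Torus
open Literature.Analysis.FluidPDE
open Summit.AnomalousDissipation.AnomalousDissipation.Theorems.UniformGalerkinTrap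
  (uniformGalerkinTrap_iff_windowInvariantSets)

/-! ### Stub 1 — the deficit–Lipschitz floor lemma (PROVED; pure real analysis) -/

/-- **Bounded deficit + time-Lipschitz ⇒ pointwise floor.** A signal `w`, continuous on `[0,∞)` and `L`-Lipschitz there
(`L > 0`), whose cumulative deficit below the level `β` is at most `C` on every window (`β (t - s) - C ≤ ∫ₛᵗ w`), never
dips below `β - √(2 C L)`: a dip of depth `d` at `t₀` forces `w ≤ β - d + L (τ - t₀)` on `[t₀, t₀ + d/L]`, a deficit
`d²/(2L) ≤ C`. [folklore] -/
theorem stub_floor :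
    ∀ (w : ℝ → ℝ) (L C β : ℝ), 0 < L → ContinuousOn w (Set.Ici 0) →
      (∀ s t : ℝ, 0 ≤ s → 0 ≤ t → |w t - w s| ≤ L * |t - s|) →
      (∀ s t : ℝ, 0 ≤ s → s ≤ t → β * (t - s) - C ≤ ∫ τ in s..t, w τ) →
      ∀ t : ℝ, 0 ≤ t → β - Real.sqrt (2 * C * L) ≤ w t := by
  intro w L C β hL hcont hlip hdef t₀ ht₀
  set d : ℝ := β - w t₀ with hd
  by_cases hdle : d ≤ 0
  · have h0 : 0 ≤ Real.sqrt (2 * C * L) := Real.sqrt_nonneg _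
    linarith
  push Not at hdle
  set h : ℝ := d / L with hh
  have hhpos : 0 < h := div_pos hdle hL
  have hLh : L * h = d := by rw [hh]; field_simp
  -- the affine majorant on the window `[t₀, t₀ + h]`
  have hle : ∀ τ ∈ Icc t₀ (t₀ + h), w τ ≤ (β - d) + L * (τ - t₀) := by
    intro τ hτ
    have hτ0 : 0 ≤ τ := le_trans ht₀ hτ.1
    have h1 := hlip t₀ τ ht₀ hτ0
    have habs : |τ - t₀| = τ - t₀ := abs_of_nonneg (by linarith [hτ.1])
    rw [habs] at h1
    have h2 : w τ - w t₀ ≤ L * (τ - t₀) := le_trans (le_abs_self _) h1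
    have hw0 : w t₀ = β - d := by rw [hd]; ring
    linarith
  -- integrability on the window
  have hIcc : Icc t₀ (t₀ + h) ⊆ Ici 0 := fun τ hτ => le_trans ht₀ hτ.1
  have hwint : IntervalIntegrable w volume t₀ (t₀ + h) := by
    apply ContinuousOn.intervalIntegrable
    rw [uIcc_of_le (by linarith)]
    exact hcont.mono hIcc
  have hgcont : Continuous fun τ : ℝ => (β - d) + L * (τ - t₀) := by fun_prop
  have hgint : IntervalIntegrable (fun τ : ℝ => (β - d) + L * (τ - t₀)) volume t₀ (t₀ + h) :=
    hgcont.intervalIntegrable _ _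
  -- the integral of the majorant, by the fundamental theorem of calculus
  have hderiv : ∀ τ ∈ uIcc t₀ (t₀ + h),
      HasDerivAt (fun τ : ℝ => (β - d - L * t₀) * τ + L / 2 * τ ^ 2) ((β - d) + L * (τ - t₀)) τ := by
    intro τ _
    have h1 : HasDerivAt (fun τ : ℝ => (β - d - L * t₀) * τ) (β - d - L * t₀) τ := by
      simpa using (hasDerivAt_id τ).const_mul (β - d - L * t₀)
    have h2 : HasDerivAt (fun τ : ℝ => L / 2 * τ ^ 2) (L / 2 * (2 * τ)) τ := by
      have h3 := (hasDerivAt_pow 2 τ).const_mul (L / 2)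
      simpa using h3
    exact (h1.add h2).congr_deriv (by ring)
  have hgval : ∫ τ in t₀..(t₀ + h), ((β - d) + L * (τ - t₀)) = (β - d) * h + L * h ^ 2 / 2 := by
    rw [intervalIntegral.integral_eq_sub_of_hasDerivAt hderiv hgint]
    ring
  -- compare with the deficit hypothesis on the same window
  have hup : ∫ τ in t₀..(t₀ + h), w τ ≤ (β - d) * h + L * h ^ 2 / 2 := by
    rw [← hgval]
    exact intervalIntegral.integral_mono_on (by linarith) hwint hgint hle
  have hlow := hdef t₀ (t₀ + h) ht₀ (by linarith)
  have hkey : (β - d) * h + L * h ^ 2 / 2 = β * h - d ^ 2 / (2 * L) := by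
    rw [hh]; field_simp; ring
  have hsq : d ^ 2 / (2 * L) ≤ C := by nlinarith [hup, hlow, hkey]
  have hsq' : d ^ 2 ≤ 2 * C * L := by
    have h2L : 0 < 2 * L := by positivity
    have := (div_le_iff₀ h2L).mp hsq
    nlinarith [this]
  have hdroot : d ≤ Real.sqrt (2 * C * L) := by
    rw [show d = Real.sqrt (d ^ 2) from (Real.sqrt_sq hdle.le).symm]
    exact Real.sqrt_le_sqrt hsq'
  linarith

/-! ### Stub 2 — Mañé's calibration lemma (abstract measure theory) -/

/-- **Calibration from bounded excess (Mañé's coboundary lemma, semiflow/measure form).** Let `φ` be a measurable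
semiflow on `X`, `μ` a `φ`-invariant probability measure, `W` a bounded measurable observable, continuous in time
along forward orbits, with mean `∫ W dμ = β`, and suppose the cumulative EXCESS of `W` above `β` along `μ`-a.e. orbit is
bounded: `∫₀ᵗ W (φ_τ x) dτ ≤ β t + C` (`t ≥ 0`). Then `μ`-a.e. orbit is calibrated: `β (t - s) - C ≤ ∫ₛᵗ W (φ_τ x) dτ`
for all `0 ≤ s ≤ t`. Proof: the sub-action `V := sup_{q ∈ ℚ≥0} (∫₀^q W∘φ - β q) ∈ [0, C]` satisfies
`V ≥ ∫₀ᵗ (W∘φ - β) + V∘φ_t`; the defect has integral `0` by invariance and Fubini, hence vanishes a.e.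
(Mañé 1996; Lopes–Thieullen 2005 Thm 1; Jenkinson 2006 Prop. 2.1–2.2). [cite: Jenkinson2006, Prop. 2.1–2.2] -/
theorem stub_calibration :
    ∀ {X : Type*} [MeasurableSpace X] (φ : ℝ → X → X) (μ : Measure X) [IsProbabilityMeasure μ]
      (W : X → ℝ) (β C : ℝ),
      (∀ t : ℝ, 0 ≤ t → Measurable (φ t)) → (∀ x, φ 0 x = x) →
      (∀ s t : ℝ, 0 ≤ s → 0 ≤ t → ∀ x, φ (s + t) x = φ s (φ t x)) →
      (∀ t : ℝ, 0 ≤ t → μ.map (φ t) = μ) →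
      Measurable W → (∃ B : ℝ, ∀ x, |W x| ≤ B) →
      (∀ x, ContinuousOn (fun t => W (φ t x)) (Set.Ici 0)) →
      ∫ x, W x ∂μ = β →
      (∀ᵐ x ∂μ, ∀ t : ℝ, 0 ≤ t → ∫ τ in (0 : ℝ)..t, W (φ τ x) ≤ β * t + C) →
      ∀ᵐ x ∂μ, ∀ s t : ℝ, 0 ≤ s → s ≤ t → β * (t - s) - C ≤ ∫ τ in s..t, W (φ τ x) :=
  -- LANDED p117641 (lead): Theorems/WazewskiBlockUniformGalerkinTrapStubCalibration.lean
  Summit.AnomalousDissipation.AnomalousDissipation.Theorems.UniformGalerkinTrap.Mane.stub_calibration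

/-! ### Stub 3 — invariant law on a closed set: a.e. forward orbit stays inside (abstract) -/

/-- **A.e. forward orbits of an invariant law carried by a closed set stay in it.** For a semiflow `φ` with measurable
time-`t` maps and forward orbits continuous on `[0,∞)`, a `φ`-invariant probability measure `μ` and a closed `K` with
`μ Kᶜ = 0`: `μ`-a.e. `x` has `φ_t x ∈ K` for all `t ≥ 0` (rational times by invariance, countably many null sets; all
times by orbit continuity and closedness). [folklore] -/
theorem stub_aeOrbitMem :
    ∀ {X : Type*} [TopologicalSpace X] [MeasurableSpace X] (φ : ℝ → X → X) (μ : Measure X)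
      [IsProbabilityMeasure μ] (K : Set X),
      (∀ t : ℝ, 0 ≤ t → Measurable (φ t)) → (∀ x, φ 0 x = x) →
      (∀ x, ContinuousOn (fun t => φ t x) (Set.Ici 0)) →
      (∀ t : ℝ, 0 ≤ t → μ.map (φ t) = μ) → IsClosed K → μ Kᶜ = 0 →
      ∀ᵐ x ∂μ, ∀ t : ℝ, 0 ≤ t → φ t x ∈ K :=
  -- LANDED p117417 (worker): Theorems/WazewskiBlockUniformGalerkinTrapStubAeOrbitMem.lean
  Summit.AnomalousDissipation.AnomalousDissipation.Theorems.UniformGalerkinTrap.Mane.stub_aeOrbitMem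

/-! ### Stub 4 — tree plumbing for the Galerkin coefficient semiflow of order `N` -/

/-- **Regularity of the Galerkin coefficient semiflow and of the injection functional.** For `ν ≥ 0`, `f ∈ L²` and an
order `N`, with `φ := galerkinCoeffFlow ν f̂|_{≤N}` on the coefficient space `↥(freqBall N) → ℂ³`: every time-`t` map
(`t ≥ 0`) is Borel measurable (continuous on the closed phase space, the identity off it); forward orbits are continuous
on `[0,∞)`; the semigroup law holds on the whole coefficient space (`galerkinCoeffFlow_add` on the phase space, identity
off it); the injection `c ↦ ∫⟪f, realTrigPoly c̄⟫` is continuous (a real-linear functional of finitely many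
coefficients); and the capped core {phase space, KE ≤ E, ‖∇·‖² ≤ G} is closed. [folklore] -/
theorem stub_galerkinRegularity :
    ∀ (ν : ℝ) (N : ℕ) (f : UnitAddTorus (Fin 3) → EuclideanSpace ℝ (Fin 3)) (E : ℝ) (G : ℝ≥0),
      0 ≤ ν → MemLp f 2 volume →
      (∀ t : ℝ, 0 ≤ t →
        Measurable (galerkinCoeffFlow ν (fourierRestrict (freqBall (d := Fin 3) N) f) t)) ∧
      (∀ c : ↥(freqBall (d := Fin 3) N) → EuclideanSpace ℂ (Fin 3),
        ContinuousOn (fun t : ℝ => galerkinCoeffFlow ν (fourierRestrict (freqBall (d := Fin 3) N) f) t c)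
          (Set.Ici 0)) ∧
      (∀ s t : ℝ, 0 ≤ s → 0 ≤ t → ∀ c : ↥(freqBall (d := Fin 3) N) → EuclideanSpace ℂ (Fin 3),
        galerkinCoeffFlow ν (fourierRestrict (freqBall (d := Fin 3) N) f) (s + t) c =
          galerkinCoeffFlow ν (fourierRestrict (freqBall (d := Fin 3) N) f) s
            (galerkinCoeffFlow ν (fourierRestrict (freqBall (d := Fin 3) N) f) t c)) ∧
      Continuous (fun c : ↥(freqBall (d := Fin 3) N) → EuclideanSpace ℂ (Fin 3) =>
        ∫ x, ⟪f x, realTrigPoly (freqBall N) (coeffExt (freqBall N) c) x⟫_ℝ) ∧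
      IsClosed {c : ↥(freqBall (d := Fin 3) N) → EuclideanSpace ℂ (Fin 3) |
        c ∈ galerkinSubspace (freqBall (d := Fin 3) N) ∧
        kineticEnergy (realTrigPoly (freqBall N) (coeffExt (freqBall N) c)) ≤ E ∧
        eGradNormSq (realTrigPoly (freqBall N) (coeffExt (freqBall N) c)) ≤ (G : ℝ≥0∞)} :=
  -- LANDED p117844 (worker): Theorems/WazewskiBlockUniformGalerkinTrapStubGalerkinRegularity.lean
  Summit.AnomalousDissipation.AnomalousDissipation.Theorems.UniformGalerkinTrap.Mane.stub_galerkinRegularity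

/-! ### Stub 5 — the injection is Lipschitz in time along energy-bounded Galerkin orbits (field level) -/

/-- **Time-Lipschitz injection.** Along a global Galerkin trajectory `U` of order `N ≥ m` driven by a Galerkin-mode
force `f` of order `m` (`ν ≥ 0`) whose energy stays `≤ E` on `[0,∞)`, if `D ≥ 0` bounds the strain of the force,
`|⟪w, Df(x) w⟫| ≤ D ‖w‖²`, then the work `W(t) = ∫⟪f, U t⟫` satisfies
`|W t - W s| ≤ (‖f‖₂² + ν (2E)^{1/2} ‖Δf‖₂ + 2 D E) |t - s|` for `s, t ≥ 0`: the tested Galerkin identity with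
`a := f` (`work_sub_work_eq_integral_workRate`) and the pointwise bound of the rate on the energy ball (stress
`|∫⟪U,(U·∇)f⟫| ≤ 2 D KE`, viscous term by Cauchy–Schwarz, `∫‖f‖²` constant). [folklore] -/
theorem stub_workLipschitz :
    ∀ (ν : ℝ) (m N : ℕ) (f : UnitAddTorus (Fin 3) → EuclideanSpace ℝ (Fin 3)) (E D : ℝ)
      (U : ℝ → UnitAddTorus (Fin 3) → EuclideanSpace ℝ (Fin 3)),
      IsGalerkinMode m f → m ≤ N → 0 ≤ ν → 0 ≤ D → Torus.IsGalerkinTrajectory ν f N U →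
      (∀ τ : ℝ, 0 ≤ τ → kineticEnergy (U τ) ≤ E) →
      (∀ (x : UnitAddTorus (Fin 3)) (w : EuclideanSpace ℝ (Fin 3)),
        |⟪w, convect (fun _ => w) f x⟫_ℝ| ≤ D * ‖w‖ ^ 2) →
      ∀ s t : ℝ, 0 ≤ s → 0 ≤ t →
        |(∫ x, ⟪f x, U t x⟫_ℝ) - ∫ x, ⟪f x, U s x⟫_ℝ| ≤
          ((∫ x, ‖f x‖ ^ 2) + ν * Real.sqrt (2 * E) * Real.sqrt (∫ x, ‖laplacian f x‖ ^ 2) + 2 * D * E) *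
            |t - s| :=
  -- LANDED p117637 (worker): Theorems/WazewskiBlockUniformGalerkinTrapStubWorkLipschitz.lean
  Summit.AnomalousDissipation.AnomalousDissipation.Theorems.UniformGalerkinTrap.Mane.stub_workLipschitz

/-! ### Stub 6 — THE BET: `BoundedExcessLoudCore` (statistical Transfer `C⁺` of the card, coefficient typing) -/

/-- **The bet `BoundedExcessLoudCore`.** There are a trig-polynomial mean-zero divergence-free force `f` of order `m` and
window constants `E, ε₀, ν₀ > 0` such that for every `0 < ν ≤ ν₀` there are a cap `G` and an order `N₀` such that for
every `N ≥ N₀` the order-`N` Galerkin coefficient semiflow `galerkinCoeffFlow ν f̂|_{≤N}` carries an invariant Borel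
probability measure `μ` on `↥(freqBall N) → ℂ³`, carried by the capped core {phase space, KE ≤ E, ‖∇·‖² ≤ G}, with
mean injection `β`, along `μ`-a.e. forward orbit the injection being `L`-Lipschitz in time with cumulative `β`-EXCESS
at most `C`, where `√(2 C L) ≤ β - ε₀`. No pointwise loudness is assumed; `β, C, L, μ` may depend on `(ν, N)`.
(Card `mane-calibrated-injection-floor`, Transfer `C⁺`, conjuncts (a)+(b).) The `L`-clause is dischargeable with the
explicit worst-case constant of `stub_workLipschitz` (`boundedExcessLoudCore_of_strainBound` below: the bet with a
strain bound of the force and NO Lipschitz clause implies this one), so positing it only adds freedom (the intrinsic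
`L` of the witness law may be far below the worst case). -/
theorem stub_boundedExcessLoudCore :
    ∃ (m : ℕ) (f : UnitAddTorus (Fin 3) → EuclideanSpace ℝ (Fin 3)),
      ((IsSmooth f ∧ IsDivFree f ∧ ∀ k : Fin 3 → ℤ, ((m : ℕ) : ℝ) ^ 2 < freqNormSq k →
        UnitAddTorus.mFourierCoeff (EuclideanSpace.complexify ∘ f) k = 0) ∧ HasZeroMean f) ∧
      ∃ (E ε₀ ν₀ : ℝ), 0 < ε₀ ∧ 0 < ν₀ ∧
        ∀ ν : ℝ, 0 < ν → ν ≤ ν₀ → ∃ (G : ℝ≥0) (N₀ : ℕ), ∀ N : ℕ, N₀ ≤ N →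
          ∃ (β C L : ℝ) (μ : Measure (↥(freqBall (d := Fin 3) N) → EuclideanSpace ℂ (Fin 3))),
            0 ≤ L ∧ Real.sqrt (2 * C * L) ≤ β - ε₀ ∧
            IsProbabilityMeasure μ ∧
            (∀ t : ℝ, 0 ≤ t →
              μ.map (galerkinCoeffFlow ν (fourierRestrict (freqBall (d := Fin 3) N) f) t) = μ) ∧
            μ {c : ↥(freqBall (d := Fin 3) N) → EuclideanSpace ℂ (Fin 3) |
                c ∈ galerkinSubspace (freqBall (d := Fin 3) N) ∧
                kineticEnergy (realTrigPoly (freqBall N) (coeffExt (freqBall N) c)) ≤ E ∧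
                eGradNormSq (realTrigPoly (freqBall N) (coeffExt (freqBall N) c)) ≤ (G : ℝ≥0∞)}ᶜ = 0 ∧
            ∫ c, (∫ x, ⟪f x, realTrigPoly (freqBall N) (coeffExt (freqBall N) c) x⟫_ℝ) ∂μ = β ∧
            (∀ᵐ c ∂μ, ∀ s t : ℝ, 0 ≤ s → 0 ≤ t →
              |(∫ x, ⟪f x, realTrigPoly (freqBall N) (coeffExt (freqBall N)
                  (galerkinCoeffFlow ν (fourierRestrict (freqBall (d := Fin 3) N) f) t c)) x⟫_ℝ) -
                ∫ x, ⟪f x, realTrigPoly (freqBall N) (coeffExt (freqBall N)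
                  (galerkinCoeffFlow ν (fourierRestrict (freqBall (d := Fin 3) N) f) s c)) x⟫_ℝ| ≤
                L * |t - s|) ∧
            (∀ᵐ c ∂μ, ∀ t : ℝ, 0 ≤ t →
              ∫ τ in (0 : ℝ)..t, (∫ x, ⟪f x, realTrigPoly (freqBall N) (coeffExt (freqBall N)
                (galerkinCoeffFlow ν (fourierRestrict (freqBall (d := Fin 3) N) f) τ c)) x⟫_ℝ) ≤
                β * t + C) := by
  sorry

/-- **The strain-bound form of the bet implies the bet** (`stub_workLipschitz` discharges the Lipschitz clause with the
explicit ν-, N-free constant `L = ‖f‖₂² + ν₀ (2E)^{1/2} ‖Δf‖₂ + 2 D E`, valid along every forward orbit of the core,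
hence along a.e. orbit of a law carried by the core, `stub_aeOrbitMem`). This records that positing an intrinsic `L`
in `stub_boundedExcessLoudCore` is a weakening of the card's purely statistical Transfer. [folklore] -/
theorem boundedExcessLoudCore_of_strainBound :
    (∃ (m : ℕ) (f : UnitAddTorus (Fin 3) → EuclideanSpace ℝ (Fin 3)),
      ((IsSmooth f ∧ IsDivFree f ∧ ∀ k : Fin 3 → ℤ, ((m : ℕ) : ℝ) ^ 2 < freqNormSq k →
        UnitAddTorus.mFourierCoeff (EuclideanSpace.complexify ∘ f) k = 0) ∧ HasZeroMean f) ∧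
      ∃ (E ε₀ ν₀ D : ℝ), 0 < ε₀ ∧ 0 < ν₀ ∧ 0 ≤ D ∧
        (∀ (x : UnitAddTorus (Fin 3)) (w : EuclideanSpace ℝ (Fin 3)),
          |⟪w, convect (fun _ => w) f x⟫_ℝ| ≤ D * ‖w‖ ^ 2) ∧
        ∀ ν : ℝ, 0 < ν → ν ≤ ν₀ → ∃ (G : ℝ≥0) (N₀ : ℕ), m ≤ N₀ ∧ ∀ N : ℕ, N₀ ≤ N →
          ∃ (β C : ℝ) (μ : Measure (↥(freqBall (d := Fin 3) N) → EuclideanSpace ℂ (Fin 3))),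
            Real.sqrt (2 * C * ((∫ x, ‖f x‖ ^ 2) + ν₀ * Real.sqrt (2 * E) *
              Real.sqrt (∫ x, ‖laplacian f x‖ ^ 2) + 2 * D * E)) ≤ β - ε₀ ∧
            IsProbabilityMeasure μ ∧
            (∀ t : ℝ, 0 ≤ t →
              μ.map (galerkinCoeffFlow ν (fourierRestrict (freqBall (d := Fin 3) N) f) t) = μ) ∧
            μ {c : ↥(freqBall (d := Fin 3) N) → EuclideanSpace ℂ (Fin 3) |
                c ∈ galerkinSubspace (freqBall (d := Fin 3) N) ∧
                kineticEnergy (realTrigPoly (freqBall N) (coeffExt (freqBall N) c)) ≤ E ∧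
                eGradNormSq (realTrigPoly (freqBall N) (coeffExt (freqBall N) c)) ≤ (G : ℝ≥0∞)}ᶜ = 0 ∧
            ∫ c, (∫ x, ⟪f x, realTrigPoly (freqBall N) (coeffExt (freqBall N) c) x⟫_ℝ) ∂μ = β ∧
            (∀ᵐ c ∂μ, ∀ t : ℝ, 0 ≤ t →
              ∫ τ in (0 : ℝ)..t, (∫ x, ⟪f x, realTrigPoly (freqBall N) (coeffExt (freqBall N)
                (galerkinCoeffFlow ν (fourierRestrict (freqBall (d := Fin 3) N) f) τ c)) x⟫_ℝ) ≤
                β * t + C)) →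
    ∃ (m : ℕ) (f : UnitAddTorus (Fin 3) → EuclideanSpace ℝ (Fin 3)),
      ((IsSmooth f ∧ IsDivFree f ∧ ∀ k : Fin 3 → ℤ, ((m : ℕ) : ℝ) ^ 2 < freqNormSq k →
        UnitAddTorus.mFourierCoeff (EuclideanSpace.complexify ∘ f) k = 0) ∧ HasZeroMean f) ∧
      ∃ (E ε₀ ν₀ : ℝ), 0 < ε₀ ∧ 0 < ν₀ ∧
        ∀ ν : ℝ, 0 < ν → ν ≤ ν₀ → ∃ (G : ℝ≥0) (N₀ : ℕ), ∀ N : ℕ, N₀ ≤ N →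
          ∃ (β C L : ℝ) (μ : Measure (↥(freqBall (d := Fin 3) N) → EuclideanSpace ℂ (Fin 3))),
            0 ≤ L ∧ Real.sqrt (2 * C * L) ≤ β - ε₀ ∧
            IsProbabilityMeasure μ ∧
            (∀ t : ℝ, 0 ≤ t →
              μ.map (galerkinCoeffFlow ν (fourierRestrict (freqBall (d := Fin 3) N) f) t) = μ) ∧
            μ {c : ↥(freqBall (d := Fin 3) N) → EuclideanSpace ℂ (Fin 3) |
                c ∈ galerkinSubspace (freqBall (d := Fin 3) N) ∧
                kineticEnergy (realTrigPoly (freqBall N) (coeffExt (freqBall N) c)) ≤ E ∧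
                eGradNormSq (realTrigPoly (freqBall N) (coeffExt (freqBall N) c)) ≤ (G : ℝ≥0∞)}ᶜ = 0 ∧
            ∫ c, (∫ x, ⟪f x, realTrigPoly (freqBall N) (coeffExt (freqBall N) c) x⟫_ℝ) ∂μ = β ∧
            (∀ᵐ c ∂μ, ∀ s t : ℝ, 0 ≤ s → 0 ≤ t →
              |(∫ x, ⟪f x, realTrigPoly (freqBall N) (coeffExt (freqBall N)
                  (galerkinCoeffFlow ν (fourierRestrict (freqBall (d := Fin 3) N) f) t c)) x⟫_ℝ) -
                ∫ x, ⟪f x, realTrigPoly (freqBall N) (coeffExt (freqBall N)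
                  (galerkinCoeffFlow ν (fourierRestrict (freqBall (d := Fin 3) N) f) s c)) x⟫_ℝ| ≤
                L * |t - s|) ∧
            (∀ᵐ c ∂μ, ∀ t : ℝ, 0 ≤ t →
              ∫ τ in (0 : ℝ)..t, (∫ x, ⟪f x, realTrigPoly (freqBall N) (coeffExt (freqBall N)
                (galerkinCoeffFlow ν (fourierRestrict (freqBall (d := Fin 3) N) f) τ c)) x⟫_ℝ) ≤
                β * t + C) := by
  rintro ⟨m, f, hF, E, ε₀, ν₀, D, hε₀, hν₀, hD, hstrain, hbet⟩
  refine ⟨m, f, hF, E, ε₀, ν₀, hε₀, hν₀, fun ν hν hνle => ?_⟩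
  obtain ⟨G, N₀, hmN₀, hN⟩ := hbet ν hν hνle
  refine ⟨G, N₀, fun N hN₀N => ?_⟩
  obtain ⟨β, C, μ, hgap, hprob, hinv, hcore, hmean, hexcess⟩ := hN N hN₀N
  have hfL2 : MemLp f 2 volume := hF.1.1.memLp 2
  have hfi : Integrable f volume := hfL2.integrable one_le_two
  have hfmode : IsGalerkinMode m f := hF.1
  have hmN : m ≤ N := hmN₀.trans hN₀N
  obtain ⟨hmeas, hcont, -, -, hKclosed⟩ := stub_galerkinRegularity ν N f E G hν.le hfL2
  have h0 : ∀ c : ↥(freqBall (d := Fin 3) N) → EuclideanSpace ℂ (Fin 3),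
      galerkinCoeffFlow ν (fourierRestrict (freqBall (d := Fin 3) N) f) 0 c = c :=
    fun c => galerkinCoeffFlow_zero c
  haveI := hprob
  have haemem := stub_aeOrbitMem (galerkinCoeffFlow ν (fourierRestrict (freqBall (d := Fin 3) N) f)) μ
    {c : ↥(freqBall (d := Fin 3) N) → EuclideanSpace ℂ (Fin 3) |
        c ∈ galerkinSubspace (freqBall (d := Fin 3) N) ∧
        kineticEnergy (realTrigPoly (freqBall N) (coeffExt (freqBall N) c)) ≤ E ∧
        eGradNormSq (realTrigPoly (freqBall N) (coeffExt (freqBall N) c)) ≤ (G : ℝ≥0∞)}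
    hmeas h0 hcont hinv hKclosed hcore
  -- the core is nonempty (it carries a probability measure), so `E ≥ 0`
  have haeK : ∀ᵐ c ∂μ, c ∈ {c : ↥(freqBall (d := Fin 3) N) → EuclideanSpace ℂ (Fin 3) |
        c ∈ galerkinSubspace (freqBall (d := Fin 3) N) ∧
        kineticEnergy (realTrigPoly (freqBall N) (coeffExt (freqBall N) c)) ≤ E ∧
        eGradNormSq (realTrigPoly (freqBall N) (coeffExt (freqBall N) c)) ≤ (G : ℝ≥0∞)} :=
    mem_ae_iff.2 hcore
  obtain ⟨c₀, hc₀⟩ := haeK.exists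
  have hE0 : 0 ≤ E := (Torus.kineticEnergy_nonneg _).trans hc₀.2.1
  have hf2 : 0 ≤ ∫ x, ‖f x‖ ^ 2 := integral_nonneg fun _ => sq_nonneg _
  refine ⟨β, C, (∫ x, ‖f x‖ ^ 2) + ν₀ * Real.sqrt (2 * E) * Real.sqrt (∫ x, ‖laplacian f x‖ ^ 2) + 2 * D * E,
    μ, by positivity, hgap, hprob, hinv, hcore, hmean, ?_, hexcess⟩
  filter_upwards [haemem] with c hmem
  have hcK := hmem 0 le_rfl
  rw [h0 c] at hcK
  obtain ⟨hcV, -, -⟩ := hcK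
  have ha : IsGalerkinMode N (realTrigPoly (freqBall N) (coeffExt (freqBall N) c)) :=
    isGalerkinMode_realTrigPoly_coeffExt hcV
  have hrestr : fourierRestrict (freqBall (d := Fin 3) N) (realTrigPoly (freqBall N) (coeffExt (freqBall N) c)) = c :=
    fourierRestrict_realTrigPoly_coeffExt neg_mem_freqBall_of_mem hcV.1
  have htraj : Torus.IsGalerkinTrajectory ν f N (fun t => realTrigPoly (freqBall N) (coeffExt (freqBall N)
      (galerkinCoeffFlow ν (fourierRestrict (freqBall (d := Fin 3) N) f) t c))) := by
    have h := (ha.isGalerkinTrajectory_galerkinFlow hν.le hfi).torus hfL2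
    rw [hrestr] at h
    exact h
  have hKEorb : ∀ τ : ℝ, 0 ≤ τ → kineticEnergy (realTrigPoly (freqBall N) (coeffExt (freqBall N)
      (galerkinCoeffFlow ν (fourierRestrict (freqBall (d := Fin 3) N) f) τ c))) ≤ E :=
    fun τ hτ => (hmem τ hτ).2.1
  have hlipν := stub_workLipschitz ν m N f E D _ hfmode hmN hν.le hD htraj hKEorb hstrain
  intro s t hs ht
  refine (hlipν s t hs ht).trans (mul_le_mul_of_nonneg_right ?_ (abs_nonneg _))
  have : ν * Real.sqrt (2 * E) * Real.sqrt (∫ x, ‖laplacian f x‖ ^ 2) ≤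
      ν₀ * Real.sqrt (2 * E) * Real.sqrt (∫ x, ‖laplacian f x‖ ^ 2) := by
    have h1 : 0 ≤ Real.sqrt (2 * E) * Real.sqrt (∫ x, ‖laplacian f x‖ ^ 2) :=
      mul_nonneg (Real.sqrt_nonneg _) (Real.sqrt_nonneg _)
    nlinarith
  linarith

/-! ### Stub 7 — the transfer `BoundedDeficitLoudCore → UniformGalerkinTrap` -/

/-- **Transfer (orbit level ⇒ crux).** If for a trig-polynomial mean-zero divergence-free force and window constants,
for every small `ν` and large `N`, some phase-space point has a forward coefficient orbit inside the capped core along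
which the injection is `L`-Lipschitz in time (`L ≥ 0`) with `β`-deficit at most `C` on every window and
`√(2 C L) ≤ β - ε₀`, then `UniformGalerkinTrap`: the floor lemma gives injection `≥ ε₀` along the orbit, whose field
`realTrigPoly (φ_t c)‾ = Torus.galerkinFlow ν f N t (realTrigPoly c̄)` sweeps a nonempty forward-invariant set of
Galerkin modes in the window; conclude by `uniformGalerkinTrap_iff_windowInvariantSets` (p105977). [folklore] -/
theorem stub_transfer :
    (∃ (m : ℕ) (f : UnitAddTorus (Fin 3) → EuclideanSpace ℝ (Fin 3)),
      ((IsSmooth f ∧ IsDivFree f ∧ ∀ k : Fin 3 → ℤ, ((m : ℕ) : ℝ) ^ 2 < freqNormSq k →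
        UnitAddTorus.mFourierCoeff (EuclideanSpace.complexify ∘ f) k = 0) ∧ HasZeroMean f) ∧
      ∃ (E ε₀ ν₀ : ℝ), 0 < ε₀ ∧ 0 < ν₀ ∧
        ∀ ν : ℝ, 0 < ν → ν ≤ ν₀ → ∃ (G : ℝ≥0) (N₀ : ℕ), ∀ N : ℕ, N₀ ≤ N →
          ∃ (β C L : ℝ) (c : ↥(freqBall (d := Fin 3) N) → EuclideanSpace ℂ (Fin 3)),
            0 ≤ L ∧ Real.sqrt (2 * C * L) ≤ β - ε₀ ∧
            c ∈ galerkinSubspace (freqBall (d := Fin 3) N) ∧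
            (∀ t : ℝ, 0 ≤ t →
              kineticEnergy (realTrigPoly (freqBall N) (coeffExt (freqBall N)
                (galerkinCoeffFlow ν (fourierRestrict (freqBall (d := Fin 3) N) f) t c))) ≤ E ∧
              eGradNormSq (realTrigPoly (freqBall N) (coeffExt (freqBall N)
                (galerkinCoeffFlow ν (fourierRestrict (freqBall (d := Fin 3) N) f) t c))) ≤ (G : ℝ≥0∞)) ∧
            (∀ s t : ℝ, 0 ≤ s → 0 ≤ t →
              |(∫ x, ⟪f x, realTrigPoly (freqBall N) (coeffExt (freqBall N)
                  (galerkinCoeffFlow ν (fourierRestrict (freqBall (d := Fin 3) N) f) t c)) x⟫_ℝ) -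
                ∫ x, ⟪f x, realTrigPoly (freqBall N) (coeffExt (freqBall N)
                  (galerkinCoeffFlow ν (fourierRestrict (freqBall (d := Fin 3) N) f) s c)) x⟫_ℝ| ≤
                L * |t - s|) ∧
            (∀ s t : ℝ, 0 ≤ s → s ≤ t →
              β * (t - s) - C ≤ ∫ τ in s..t, (∫ x, ⟪f x, realTrigPoly (freqBall N) (coeffExt (freqBall N)
                (galerkinCoeffFlow ν (fourierRestrict (freqBall (d := Fin 3) N) f) τ c)) x⟫_ℝ))) →
    Summit.AnomalousDissipation.AnomalousDissipation.Theses.WazewskiBlock.UniformGalerkinTrap := by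
  rintro ⟨m, f, hF, E, ε₀, ν₀, hε₀, hν₀, h⟩
  rw [uniformGalerkinTrap_iff_windowInvariantSets]
  refine ⟨m, f, hF, E, ε₀, ν₀, hε₀, hν₀, fun ν hν hνle => ?_⟩
  obtain ⟨G, N₀, hN⟩ := h ν hν hνle
  refine ⟨G, N₀, fun N hN₀ => ?_⟩
  obtain ⟨β, C, L, c, hL, hgap, hcV, horb, hlip, hdef⟩ := hN N hN₀
  have hfi : Integrable f volume := (hF.1.1.memLp 2).integrable one_le_two
  -- the Galerkin mode swept by the coefficient orbit, and its field-level orbit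
  have ha : IsGalerkinMode N (realTrigPoly (freqBall N) (coeffExt (freqBall N) c)) :=
    isGalerkinMode_realTrigPoly_coeffExt hcV
  have hflow : ∀ t : ℝ, Torus.galerkinFlow ν f N t (realTrigPoly (freqBall N) (coeffExt (freqBall N) c)) =
      realTrigPoly (freqBall N) (coeffExt (freqBall N)
        (galerkinCoeffFlow ν (fourierRestrict (freqBall N) f) t c)) :=
    fun t => Torus.galerkinFlow_realTrigPoly hcV t
  -- the injection signal along the orbit
  obtain ⟨w, hw_def⟩ : ∃ w : ℝ → ℝ, w = fun t => ∫ x, ⟪f x, realTrigPoly (freqBall N) (coeffExt (freqBall N)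
      (galerkinCoeffFlow ν (fourierRestrict (freqBall N) f) t c)) x⟫_ℝ := ⟨_, rfl⟩
  have hwlip : ∀ s t : ℝ, 0 ≤ s → 0 ≤ t → |w t - w s| ≤ L * |t - s| := fun s t hs ht => by
    rw [hw_def]; exact hlip s t hs ht
  have hwdef : ∀ s t : ℝ, 0 ≤ s → s ≤ t → β * (t - s) - C ≤ ∫ τ in s..t, w τ := fun s t hs hst => by
    rw [hw_def]; exact hdef s t hs hst
  -- continuity on `[0,∞)` from the Lipschitz bound (with the positive constant `L + 1`)
  have hwcont : ContinuousOn w (Ici 0) := by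
    rw [Metric.continuousOn_iff]
    intro t ht ε hε
    refine ⟨ε / (L + 1), div_pos hε (by linarith), fun s hs hst => ?_⟩
    rw [Real.dist_eq]
    have h1 : |w s - w t| ≤ L * |s - t| := hwlip t s ht hs
    have h2 : |s - t| < ε / (L + 1) := by rwa [← Real.dist_eq]
    have h3 : L * |s - t| ≤ (L + 1) * |s - t| :=
      mul_le_mul_of_nonneg_right (by linarith) (abs_nonneg _)
    have h4 : (L + 1) * |s - t| < (L + 1) * (ε / (L + 1)) := mul_lt_mul_of_pos_left h2 (by linarith)
    have h5 : (L + 1) * (ε / (L + 1)) = ε := by field_simp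
    linarith
  -- the pointwise floor along the orbit (floor lemma with `L + δ`, then `δ → 0`)
  have hfloor : ∀ t : ℝ, 0 ≤ t → ε₀ ≤ w t := by
    intro t ht
    have hδ : ∀ δ : ℝ, 0 < δ → β - Real.sqrt (2 * C * (L + δ)) ≤ w t := by
      intro δ hδ
      refine stub_floor w (L + δ) C β (by linarith) hwcont (fun s u hs hu => ?_) hwdef t ht
      exact (hwlip s u hs hu).trans (mul_le_mul_of_nonneg_right (by linarith) (abs_nonneg _))
    have hlim : Tendsto (fun δ : ℝ => β - Real.sqrt (2 * C * (L + δ))) (𝓝[>] 0)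
        (𝓝 (β - Real.sqrt (2 * C * (L + 0)))) := by
      refine tendsto_nhdsWithin_of_tendsto_nhds ?_
      have hc : Continuous fun δ : ℝ => β - Real.sqrt (2 * C * (L + δ)) := by fun_prop
      exact hc.tendsto 0
    rw [add_zero] at hlim
    have hev : ∀ᶠ δ in 𝓝[>] (0 : ℝ), β - Real.sqrt (2 * C * (L + δ)) ≤ w t :=
      eventually_nhdsWithin_of_forall fun δ hδ' => hδ δ hδ'
    have := le_of_tendsto hlim hev
    linarith
  refine ⟨(fun t => Torus.galerkinFlow ν f N t (realTrigPoly (freqBall N) (coeffExt (freqBall N) c))) '' Ici 0,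
    ⟨realTrigPoly (freqBall N) (coeffExt (freqBall N) c), 0, mem_Ici.2 le_rfl, Torus.galerkinFlow_zero _⟩,
    ?_, ?_, ?_⟩
  · rintro b ⟨τ, _, rfl⟩
    exact ha.isGalerkinMode_galerkinFlow τ
  · rintro b ⟨τ, hτ, rfl⟩ t ht
    exact ⟨t + τ, mem_Ici.2 (add_nonneg ht hτ), ha.galerkinFlow_add hν.le hfi ht hτ⟩
  · rintro b ⟨τ, hτ, rfl⟩
    obtain ⟨hKE, hZ⟩ := horb τ hτ
    have hW := hfloor τ hτ
    rw [hw_def] at hW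
    refine ⟨?_, ?_, ?_⟩
    · simpa only [hflow τ] using hKE
    · simpa only [hflow τ] using hW
    · simpa only [hflow τ] using hZ

/-! ### The composition -/

/-- **Glue (statistical ⇒ orbit level): `BoundedDeficitLoudCore` from the stubs.** The bet's invariant law is carried by
the closed capped core, so a.e. forward orbit stays in it (`stub_aeOrbitMem`); on the core the injection is bounded by
`‖f‖₂(2E)^{1/2}`, so its truncation at that level is a bounded continuous observable with the same mean and the same
excess along a.e. orbit; Mañé's lemma (`stub_calibration`) calibrates a.e. orbit; one such point, with its forward orbit
in the core and Lipschitz injection along it, is selected (an a.e. property on a probability space has a witness). -/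
theorem boundedDeficitLoudCore_of_stubs :
    ∃ (m : ℕ) (f : UnitAddTorus (Fin 3) → EuclideanSpace ℝ (Fin 3)),
      ((IsSmooth f ∧ IsDivFree f ∧ ∀ k : Fin 3 → ℤ, ((m : ℕ) : ℝ) ^ 2 < freqNormSq k →
        UnitAddTorus.mFourierCoeff (EuclideanSpace.complexify ∘ f) k = 0) ∧ HasZeroMean f) ∧
      ∃ (E ε₀ ν₀ : ℝ), 0 < ε₀ ∧ 0 < ν₀ ∧
        ∀ ν : ℝ, 0 < ν → ν ≤ ν₀ → ∃ (G : ℝ≥0) (N₀ : ℕ), ∀ N : ℕ, N₀ ≤ N →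
          ∃ (β C L : ℝ) (c : ↥(freqBall (d := Fin 3) N) → EuclideanSpace ℂ (Fin 3)),
            0 ≤ L ∧ Real.sqrt (2 * C * L) ≤ β - ε₀ ∧
            c ∈ galerkinSubspace (freqBall (d := Fin 3) N) ∧
            (∀ t : ℝ, 0 ≤ t →
              kineticEnergy (realTrigPoly (freqBall N) (coeffExt (freqBall N)
                (galerkinCoeffFlow ν (fourierRestrict (freqBall (d := Fin 3) N) f) t c))) ≤ E ∧
              eGradNormSq (realTrigPoly (freqBall N) (coeffExt (freqBall N)
                (galerkinCoeffFlow ν (fourierRestrict (freqBall (d := Fin 3) N) f) t c))) ≤ (G : ℝ≥0∞)) ∧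
            (∀ s t : ℝ, 0 ≤ s → 0 ≤ t →
              |(∫ x, ⟪f x, realTrigPoly (freqBall N) (coeffExt (freqBall N)
                  (galerkinCoeffFlow ν (fourierRestrict (freqBall (d := Fin 3) N) f) t c)) x⟫_ℝ) -
                ∫ x, ⟪f x, realTrigPoly (freqBall N) (coeffExt (freqBall N)
                  (galerkinCoeffFlow ν (fourierRestrict (freqBall (d := Fin 3) N) f) s c)) x⟫_ℝ| ≤
                L * |t - s|) ∧
            (∀ s t : ℝ, 0 ≤ s → s ≤ t →
              β * (t - s) - C ≤ ∫ τ in s..t, (∫ x, ⟪f x, realTrigPoly (freqBall N) (coeffExt (freqBall N)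
                (galerkinCoeffFlow ν (fourierRestrict (freqBall (d := Fin 3) N) f) τ c)) x⟫_ℝ)) := by
  obtain ⟨m, f, hF, E, ε₀, ν₀, hε₀, hν₀, hbet⟩ := stub_boundedExcessLoudCore
  refine ⟨m, f, hF, E, ε₀, ν₀, hε₀, hν₀, fun ν hν hνle => ?_⟩
  obtain ⟨G, N₀, hN⟩ := hbet ν hν hνle
  refine ⟨G, N₀, fun N hN₀N => ?_⟩
  obtain ⟨β, C, L, μ, hL, hgap, hprob, hinv, hcore, hmean, hlipae, hexcess⟩ := hN N hN₀N
  have hfL2 : MemLp f 2 volume := hF.1.1.memLp 2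
  -- tree plumbing for the coefficient semiflow of order `N`
  obtain ⟨hmeas, hcont, hsemi, hWcont, hKclosed⟩ := stub_galerkinRegularity ν N f E G hν.le hfL2
  have h0 : ∀ c : ↥(freqBall (d := Fin 3) N) → EuclideanSpace ℂ (Fin 3),
      galerkinCoeffFlow ν (fourierRestrict (freqBall (d := Fin 3) N) f) 0 c = c :=
    fun c => galerkinCoeffFlow_zero c
  -- a.e. forward orbit stays in the (closed) capped core
  have haemem := stub_aeOrbitMem (galerkinCoeffFlow ν (fourierRestrict (freqBall (d := Fin 3) N) f)) μ
    {c : ↥(freqBall (d := Fin 3) N) → EuclideanSpace ℂ (Fin 3) |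
        c ∈ galerkinSubspace (freqBall (d := Fin 3) N) ∧
        kineticEnergy (realTrigPoly (freqBall N) (coeffExt (freqBall N) c)) ≤ E ∧
        eGradNormSq (realTrigPoly (freqBall N) (coeffExt (freqBall N) c)) ≤ (G : ℝ≥0∞)}
    hmeas h0 hcont hinv hKclosed hcore
  -- the injection is bounded on the core: `|∫⟪f, v⟫| ≤ ‖f‖₂ (2E)^{1/2}`
  set B : ℝ := Real.sqrt (∫ x, ‖f x‖ ^ 2) * Real.sqrt (2 * E) with hB
  have hB0 : 0 ≤ B := mul_nonneg (Real.sqrt_nonneg _) (Real.sqrt_nonneg _)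
  have hWB : ∀ c : ↥(freqBall (d := Fin 3) N) → EuclideanSpace ℂ (Fin 3),
      kineticEnergy (realTrigPoly (freqBall N) (coeffExt (freqBall N) c)) ≤ E →
      |∫ x, ⟪f x, realTrigPoly (freqBall N) (coeffExt (freqBall N) c) x⟫_ℝ| ≤ B := by
    intro c hKE
    refine (abs_integral_inner_le_sqrt_sq_mul_sqrt_sq hfL2 (memLp_realTrigPoly _ _ 2)).trans ?_
    refine mul_le_mul_of_nonneg_left (Real.sqrt_le_sqrt ?_) (Real.sqrt_nonneg _)
    have : ∫ x, ‖realTrigPoly (freqBall N) (coeffExt (freqBall N) c) x‖ ^ 2 =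
        2 * kineticEnergy (realTrigPoly (freqBall N) (coeffExt (freqBall N) c)) := by
      simp only [kineticEnergy]; ring
    rw [this]; linarith
  -- the truncated injection: bounded, continuous, equal to the injection on the core
  obtain ⟨Wt, hWt_def⟩ : ∃ Wt : (↥(freqBall (d := Fin 3) N) → EuclideanSpace ℂ (Fin 3)) → ℝ,
      Wt = fun c => max (-B) (min B (∫ x, ⟪f x, realTrigPoly (freqBall N) (coeffExt (freqBall N) c) x⟫_ℝ)) :=
    ⟨_, rfl⟩
  have hWtcont : Continuous Wt := by
    rw [hWt_def]; exact continuous_const.max (continuous_const.min hWcont)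
  have hWtmeas : Measurable Wt := hWtcont.measurable
  have hWtb : ∃ B' : ℝ, ∀ c, |Wt c| ≤ B' := ⟨B, fun c => by
    rw [hWt_def]
    exact abs_le.2 ⟨le_max_left _ _, max_le (by linarith) (min_le_left _ _)⟩⟩
  have hWt_eq : ∀ c : ↥(freqBall (d := Fin 3) N) → EuclideanSpace ℂ (Fin 3),
      kineticEnergy (realTrigPoly (freqBall N) (coeffExt (freqBall N) c)) ≤ E →
      Wt c = ∫ x, ⟪f x, realTrigPoly (freqBall N) (coeffExt (freqBall N) c) x⟫_ℝ := by
    intro c hKE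
    have h := abs_le.1 (hWB c hKE)
    rw [hWt_def]
    simp only
    rw [min_eq_right h.2, max_eq_right h.1]
  have hWtorbit : ∀ c, ContinuousOn
      (fun t => Wt (galerkinCoeffFlow ν (fourierRestrict (freqBall (d := Fin 3) N) f) t c)) (Ici 0) :=
    fun c => hWtcont.comp_continuousOn (hcont c)
  -- the truncated injection has the same mean and the same excess bound
  haveI := hprob
  have haeK : ∀ᵐ c ∂μ, c ∈ {c : ↥(freqBall (d := Fin 3) N) → EuclideanSpace ℂ (Fin 3) |
        c ∈ galerkinSubspace (freqBall (d := Fin 3) N) ∧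
        kineticEnergy (realTrigPoly (freqBall N) (coeffExt (freqBall N) c)) ≤ E ∧
        eGradNormSq (realTrigPoly (freqBall N) (coeffExt (freqBall N) c)) ≤ (G : ℝ≥0∞)} :=
    mem_ae_iff.2 hcore
  have hmean' : ∫ c, Wt c ∂μ = β := by
    rw [← hmean]
    refine integral_congr_ae ?_
    filter_upwards [haeK] with c hc
    exact hWt_eq c hc.2.1
  have hexcess' : ∀ᵐ c ∂μ, ∀ t : ℝ, 0 ≤ t →
      ∫ τ in (0 : ℝ)..t, Wt (galerkinCoeffFlow ν (fourierRestrict (freqBall (d := Fin 3) N) f) τ c) ≤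
        β * t + C := by
    filter_upwards [hexcess, haemem] with c hc hmem
    intro t ht
    have heq : ∫ τ in (0 : ℝ)..t, Wt (galerkinCoeffFlow ν (fourierRestrict (freqBall (d := Fin 3) N) f) τ c) =
        ∫ τ in (0 : ℝ)..t, (∫ x, ⟪f x, realTrigPoly (freqBall N) (coeffExt (freqBall N)
          (galerkinCoeffFlow ν (fourierRestrict (freqBall (d := Fin 3) N) f) τ c)) x⟫_ℝ) := by
      refine intervalIntegral.integral_congr fun τ hτ => ?_
      rw [uIcc_of_le ht] at hτ
      exact hWt_eq _ (hmem τ hτ.1).2.1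
    rw [heq]; exact hc t ht
  -- Mañé calibration for the truncated injection
  have hcal := stub_calibration (galerkinCoeffFlow ν (fourierRestrict (freqBall (d := Fin 3) N) f)) μ Wt β C
    hmeas h0 hsemi hinv hWtmeas hWtb hWtorbit hmean' hexcess'
  -- select one calibrated point whose forward orbit stays in the core and has Lipschitz injection
  obtain ⟨c, hmem, hdef, hlip⟩ := (haemem.and (hcal.and hlipae)).exists
  have hcK := hmem 0 le_rfl
  rw [h0 c] at hcK
  obtain ⟨hcV, -, -⟩ := hcK
  refine ⟨β, C, L, c, hL, hgap, hcV, fun t ht => (hmem t ht).2, hlip, fun s t hs hst => ?_⟩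
  have h := hdef s t hs hst
  have heq : ∫ τ in s..t, Wt (galerkinCoeffFlow ν (fourierRestrict (freqBall (d := Fin 3) N) f) τ c) =
      ∫ τ in s..t, (∫ x, ⟪f x, realTrigPoly (freqBall N) (coeffExt (freqBall N)
        (galerkinCoeffFlow ν (fourierRestrict (freqBall (d := Fin 3) N) f) τ c)) x⟫_ℝ) := by
    refine intervalIntegral.integral_congr fun τ hτ => ?_
    rw [uIcc_of_le hst] at hτ
    exact hWt_eq _ (hmem τ (hs.trans hτ.1)).2.1
  rwa [heq] at h

/-- **The line's composition**: `stub_transfer` applied to `boundedDeficitLoudCore_of_stubs`. This is the ONLY theorem of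
the file concluding the crux. -/
theorem UniformGalerkinTrap_of :
    Summit.AnomalousDissipation.AnomalousDissipation.Theses.WazewskiBlock.UniformGalerkinTrap :=
  stub_transfer boundedDeficitLoudCore_of_stubs

end Summit.AnomalousDissipation.AnomalousDissipation.Cruxes.UniformGalerkinTrap.SketchIdeator5

end
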